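import Mathlib
import HarnessLib
import Literature.NumberTheory.LFunctions.VanDerCorputZeta

/-!
# Multidimensional partial summation with difference conditions (Robert–Sargos, Lemma 2, `k ≤ 3`)

Topic `Literature/NumberTheory/LFunctions`. Everything in this file is PROVED (no `sorry`, no named
facts). Lemma 2 of O. Robert, P. Sargos, *A fourth derivative test for exponential sums*, Compositio
Math. 130 (2002), 275–292 (= arXiv:2307.03562) is the `k`-dimensional partial summation
`∑_i |∑_{𝐦 ∈ P} a_i(𝐦) φ_i(𝐦)| ≤ 2^k D max_{P'} ∑_i |∑_{𝐦 ∈ P'} a_i(𝐦)|` (boxes `P' = ∏[1, M'_j] ⊂ P`),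
for weights `φ_i` whose mixed partial derivatives satisfy `|∂^r φ_i/∂x_{j₁}⋯∂x_{j_r}| ≤ D/(M_{j₁}⋯M_{j_r})`
uniformly in `i`. It is used with `k = 3` in Step 4 of the proof of their Theorem 1.

Here the lemma is proved for `k = 1, 2, 3` in a DISCRETE form — the hypotheses are bounds for the
mixed finite differences of `φ_i` on the box (which follow from the printed derivative bounds by the
mean value theorem, and which are what the printed induction actually uses), the conclusion is
stated against any common bound `Mx` of the sums `∑_i ‖∑_{𝐦 ∈ P'} a_i(𝐦)‖` over corner sub-boxes:

* `Literature.NumberTheory.LFunctions.RobertSargos.partialSummation₁` — `k = 1`, constant `2D`;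
* `Literature.NumberTheory.LFunctions.RobertSargos.partialSummation₂` — `k = 2`, constant `4D`;
* `Literature.NumberTheory.LFunctions.RobertSargos.partialSummation₃` — `k = 3`, constant `8D`.

The proof is the printed induction: Abel summation (`Finset.sum_range_by_parts`) in the last
variable, then the lower-dimensional statement for the boundary term (constant `D`) and for each of
the difference terms (constant `D/M_k`, at most `M_k - 1` of them).

The second part of the file bounds the mixed differences of `e(U(q,h,n))`, `e(x) = exp(2πix)`, by
products of mixed differences of the real phase `U` (elementary identities such as
`Δ₁Δ₂ e(U) = e(U)[(e(Δ₁U) - 1)(e(Δ₂U) - 1) + e(Δ₁U + Δ₂U)(e(Δ₁Δ₂U) - 1)]` and `|e(x) - 1| ≤ 2π|x|`),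
which is how the hypothesis "`D ≪ 1` since `Q⁴λ ≪ 1`" of Step 4 of the printed proof is verified.

## References

* O. Robert, P. Sargos, *A fourth derivative test for exponential sums*, Compositio Math. 130 (2002),
  275–292 (= arXiv:2307.03562), Lemma 2 and Step 4 of §4.
-/

namespace Literature.NumberTheory.LFunctions
namespace RobertSargos

open Finset

/-! ### Dimension 1 -/

/-- **Partial summation, `k = 1`.** If `‖φ_i(N-1)‖ ≤ D` and `‖φ_i(n+1) - φ_i(n)‖ ≤ D/N` on
`[0, N)`, uniformly in `i ∈ I`, and `∑_i ‖∑_{n<N'} a_i(n)‖ ≤ Mx` for all `N' ≤ N`, then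
`∑_i ‖∑_{n<N} a_i(n) φ_i(n)‖ ≤ 2 D Mx`. [cite: RobertSargos2002, Lemma 2] -/
theorem partialSummation₁ {ι : Type*} (I : Finset ι) (N : ℕ) (a φ : ι → ℕ → ℂ) {D Mx : ℝ}
    (hD : 0 ≤ D)
    (hφ : ∀ i ∈ I, ∀ n, n < N → ‖φ i n‖ ≤ D)
    (hΔ : ∀ i ∈ I, ∀ n, n + 1 < N → ‖φ i (n + 1) - φ i n‖ ≤ D / N)
    (hMx : ∀ N', N' ≤ N → ∑ i ∈ I, ‖∑ n ∈ Finset.range N', a i n‖ ≤ Mx) :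
    ∑ i ∈ I, ‖∑ n ∈ Finset.range N, a i n * φ i n‖ ≤ 2 * D * Mx := by
  have hMx0 : 0 ≤ Mx := by
    have := hMx 0 (Nat.zero_le _); simpa using this
  rcases Nat.eq_zero_or_pos N with hN | hN
  · subst hN; simp; positivity
  have hNR : (0 : ℝ) < N := by exact_mod_cast hN
  -- Abel summation for each `i`
  have abel : ∀ i, ∑ n ∈ Finset.range N, a i n * φ i n =
      φ i (N - 1) * ∑ n ∈ Finset.range N, a i n -
        ∑ n ∈ Finset.range (N - 1), (φ i (n + 1) - φ i n) * ∑ j ∈ Finset.range (n + 1), a i j := by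
    intro i
    have := Finset.sum_range_by_parts (φ i) (a i) N
    simp only [smul_eq_mul] at this
    rw [← this]
    exact Finset.sum_congr rfl fun n _ => mul_comm _ _
  have hbound : ∀ i ∈ I, ‖∑ n ∈ Finset.range N, a i n * φ i n‖ ≤
      D * ‖∑ n ∈ Finset.range N, a i n‖ +
        ∑ n ∈ Finset.range (N - 1), D / N * ‖∑ j ∈ Finset.range (n + 1), a i j‖ := by
    intro i hi
    rw [abel i]
    refine (norm_sub_le _ _).trans (add_le_add ?_ ?_)
    · rw [norm_mul]
      exact mul_le_mul_of_nonneg_right (hφ i hi (N - 1) (Nat.sub_lt hN one_pos)) (norm_nonneg _)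
    · refine (norm_sum_le _ _).trans (Finset.sum_le_sum fun n hn => ?_)
      rw [Finset.mem_range] at hn
      rw [norm_mul]
      exact mul_le_mul_of_nonneg_right (hΔ i hi n (by omega)) (norm_nonneg _)
  calc ∑ i ∈ I, ‖∑ n ∈ Finset.range N, a i n * φ i n‖
      ≤ ∑ i ∈ I, (D * ‖∑ n ∈ Finset.range N, a i n‖ +
          ∑ n ∈ Finset.range (N - 1), D / N * ‖∑ j ∈ Finset.range (n + 1), a i j‖) :=
        Finset.sum_le_sum hbound
    _ = D * ∑ i ∈ I, ‖∑ n ∈ Finset.range N, a i n‖ +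
          D / N * ∑ n ∈ Finset.range (N - 1), ∑ i ∈ I, ‖∑ j ∈ Finset.range (n + 1), a i j‖ := by
        rw [Finset.sum_add_distrib, Finset.mul_sum, Finset.mul_sum, Finset.sum_comm]
        congr 1
        exact Finset.sum_congr rfl fun n _ => by rw [Finset.mul_sum]
    _ ≤ D * Mx + D / N * ∑ n ∈ Finset.range (N - 1), Mx := by
        apply add_le_add
        · exact mul_le_mul_of_nonneg_left (hMx N le_rfl) hD
        · apply mul_le_mul_of_nonneg_left _ (by positivity)
          exact Finset.sum_le_sum fun n hn => hMx (n + 1) (by rw [Finset.mem_range] at hn; omega)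
    _ = D * Mx + D / N * ((N - 1 : ℕ) * Mx) := by rw [Finset.sum_const, Finset.card_range, nsmul_eq_mul]
    _ ≤ 2 * D * Mx := by
        have h1 : ((N - 1 : ℕ) : ℝ) ≤ N := by exact_mod_cast Nat.sub_le N 1
        have h2 : D / N * ((N - 1 : ℕ) * Mx) ≤ D / N * (N * Mx) :=
          mul_le_mul_of_nonneg_left (mul_le_mul_of_nonneg_right h1 hMx0) (by positivity)
        have h3 : D / N * (N * Mx) = D * Mx := by field_simp
        linarith

/-! ### Dimension 2 -/

/-- **Partial summation, `k = 2`.** Box `[0,A) × [0,B)`; hypotheses: `‖φ‖ ≤ D`,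
`‖Δ₁φ‖ ≤ D/A`, `‖Δ₂φ‖ ≤ D/B`, `‖Δ₁Δ₂φ‖ ≤ D/(AB)` on the box (uniformly in `i`), and
`∑_i ‖∑_{q<A'} ∑_{h<B'} a_i(q,h)‖ ≤ Mx` for all `A' ≤ A`, `B' ≤ B`. Then
`∑_i ‖∑_{q<A} ∑_{h<B} a_i(q,h) φ_i(q,h)‖ ≤ 4 D Mx`. [cite: RobertSargos2002, Lemma 2] -/
theorem partialSummation₂ {ι : Type*} (I : Finset ι) (A B : ℕ) (a φ : ι → ℕ → ℕ → ℂ) {D Mx : ℝ}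
    (hD : 0 ≤ D)
    (hφ : ∀ i ∈ I, ∀ q h, q < A → h < B → ‖φ i q h‖ ≤ D)
    (hΔ₁ : ∀ i ∈ I, ∀ q h, q + 1 < A → h < B → ‖φ i (q + 1) h - φ i q h‖ ≤ D / A)
    (hΔ₂ : ∀ i ∈ I, ∀ q h, q < A → h + 1 < B → ‖φ i q (h + 1) - φ i q h‖ ≤ D / B)
    (hΔ₁₂ : ∀ i ∈ I, ∀ q h, q + 1 < A → h + 1 < B →
      ‖φ i (q + 1) (h + 1) - φ i (q + 1) h - φ i q (h + 1) + φ i q h‖ ≤ D / (A * B))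
    (hMx : ∀ A' B', A' ≤ A → B' ≤ B →
      ∑ i ∈ I, ‖∑ q ∈ Finset.range A', ∑ h ∈ Finset.range B', a i q h‖ ≤ Mx) :
    ∑ i ∈ I, ‖∑ q ∈ Finset.range A, ∑ h ∈ Finset.range B, a i q h * φ i q h‖ ≤ 4 * D * Mx := by
  have hMx0 : 0 ≤ Mx := by
    have := hMx 0 0 (Nat.zero_le _) (Nat.zero_le _); simpa using this
  rcases Nat.eq_zero_or_pos B with hB | hB
  · subst hB; simp; positivity
  have hBR : (0 : ℝ) < B := by exact_mod_cast hB
  -- partial sums in `h`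
  set G : ι → ℕ → ℕ → ℂ := fun i q k => ∑ h ∈ Finset.range k, a i q h with hG
  -- Abel summation in `h` for each `(i, q)`
  have abel : ∀ i q, ∑ h ∈ Finset.range B, a i q h * φ i q h =
      φ i q (B - 1) * G i q B -
        ∑ h ∈ Finset.range (B - 1), (φ i q (h + 1) - φ i q h) * G i q (h + 1) := by
    intro i q
    have := Finset.sum_range_by_parts (φ i q) (a i q) B
    simp only [smul_eq_mul] at this
    rw [hG, ← this]
    exact Finset.sum_congr rfl fun n _ => mul_comm _ _
  -- rewrite the double sum
  have hrw : ∀ i, ∑ q ∈ Finset.range A, ∑ h ∈ Finset.range B, a i q h * φ i q h =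
      ∑ q ∈ Finset.range A, G i q B * φ i q (B - 1) -
        ∑ h ∈ Finset.range (B - 1), ∑ q ∈ Finset.range A, G i q (h + 1) * (φ i q (h + 1) - φ i q h) := by
    intro i
    rw [Finset.sum_congr rfl fun q _ => abel i q, Finset.sum_sub_distrib, Finset.sum_comm]
    congr 1
    · exact Finset.sum_congr rfl fun q _ => mul_comm _ _
    · exact Finset.sum_congr rfl fun h _ => Finset.sum_congr rfl fun q _ => mul_comm _ _
  -- the boundary term: `k = 1` with weights `φ(·, B-1)`
  have hT₁ : ∑ i ∈ I, ‖∑ q ∈ Finset.range A, G i q B * φ i q (B - 1)‖ ≤ 2 * D * Mx := by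
    apply partialSummation₁ I A (fun i q => G i q B) (fun i q => φ i q (B - 1)) hD
    · intro i hi q hq; exact hφ i hi q (B - 1) hq (Nat.sub_lt hB one_pos)
    · intro i hi q hq; exact hΔ₁ i hi q (B - 1) hq (Nat.sub_lt hB one_pos)
    · intro A' hA'
      have := hMx A' B hA' le_rfl
      simpa [hG] using this
  -- the difference terms: `k = 1` with weights `Δ₂φ(·, h)` and constant `D/B`
  have hT₂ : ∀ h, h + 1 < B →
      ∑ i ∈ I, ‖∑ q ∈ Finset.range A, G i q (h + 1) * (φ i q (h + 1) - φ i q h)‖ ≤ 2 * (D / B) * Mx := by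
    intro h hh
    apply partialSummation₁ I A (fun i q => G i q (h + 1)) (fun i q => φ i q (h + 1) - φ i q h)
      (by positivity)
    · intro i hi q hq; exact hΔ₂ i hi q h hq hh
    · intro i hi q hq
      have := hΔ₁₂ i hi q h hq hh
      calc _ = ‖φ i (q + 1) (h + 1) - φ i (q + 1) h - φ i q (h + 1) + φ i q h‖ := by
            congr 1; ring
        _ ≤ D / (A * B) := this
        _ = D / B / A := by rw [div_div, mul_comm]
    · intro A' hA'
      have := hMx A' (h + 1) hA' hh.le
      simpa [hG] using this
  calc ∑ i ∈ I, ‖∑ q ∈ Finset.range A, ∑ h ∈ Finset.range B, a i q h * φ i q h‖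
      = ∑ i ∈ I, ‖∑ q ∈ Finset.range A, G i q B * φ i q (B - 1) -
          ∑ h ∈ Finset.range (B - 1), ∑ q ∈ Finset.range A, G i q (h + 1) * (φ i q (h + 1) - φ i q h)‖ := by
        refine Finset.sum_congr rfl fun i _ => ?_; rw [hrw i]
    _ ≤ ∑ i ∈ I, (‖∑ q ∈ Finset.range A, G i q B * φ i q (B - 1)‖ +
          ∑ h ∈ Finset.range (B - 1), ‖∑ q ∈ Finset.range A, G i q (h + 1) * (φ i q (h + 1) - φ i q h)‖) := by
        refine Finset.sum_le_sum fun i _ => (norm_sub_le _ _).trans (add_le_add le_rfl (norm_sum_le _ _))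
    _ = ∑ i ∈ I, ‖∑ q ∈ Finset.range A, G i q B * φ i q (B - 1)‖ +
          ∑ h ∈ Finset.range (B - 1), ∑ i ∈ I, ‖∑ q ∈ Finset.range A, G i q (h + 1) * (φ i q (h + 1) - φ i q h)‖ := by
        rw [Finset.sum_add_distrib, Finset.sum_comm]
    _ ≤ 2 * D * Mx + ∑ h ∈ Finset.range (B - 1), 2 * (D / B) * Mx := by
        apply add_le_add hT₁
        exact Finset.sum_le_sum fun h hh => hT₂ h (by rw [Finset.mem_range] at hh; omega)
    _ = 2 * D * Mx + (B - 1 : ℕ) * (2 * (D / B) * Mx) := by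
        rw [Finset.sum_const, Finset.card_range, nsmul_eq_mul]
    _ ≤ 4 * D * Mx := by
        have h1 : ((B - 1 : ℕ) : ℝ) ≤ B := by exact_mod_cast Nat.sub_le B 1
        have h2 : ((B - 1 : ℕ) : ℝ) * (2 * (D / B) * Mx) ≤ B * (2 * (D / B) * Mx) :=
          mul_le_mul_of_nonneg_right h1 (by positivity)
        have h3 : (B : ℝ) * (2 * (D / B) * Mx) = 2 * D * Mx := by field_simp
        linarith

/-! ### Dimension 3 -/

/-- **Partial summation, `k = 3`** (the case used by Robert–Sargos). Box `[0,A) × [0,B) × [0,C)`;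
hypotheses: the eight mixed differences of `φ_i` are bounded by `D`, `D/A`, `D/B`, `D/(AB)`, `D/C`,
`D/(AC)`, `D/(BC)`, `D/(ABC)` on the box, uniformly in `i`, and
`∑_i ‖∑_{q<A'} ∑_{h<B'} ∑_{n<C'} a_i‖ ≤ Mx` for all corner sub-boxes. Then
`∑_i ‖∑_{q<A} ∑_{h<B} ∑_{n<C} a_i φ_i‖ ≤ 8 D Mx`. [cite: RobertSargos2002, Lemma 2] -/
theorem partialSummation₃ {ι : Type*} (I : Finset ι) (A B C : ℕ) (a φ : ι → ℕ → ℕ → ℕ → ℂ)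
    {D Mx : ℝ} (hD : 0 ≤ D)
    (hφ : ∀ i ∈ I, ∀ q h n, q < A → h < B → n < C → ‖φ i q h n‖ ≤ D)
    (hΔ₁ : ∀ i ∈ I, ∀ q h n, q + 1 < A → h < B → n < C → ‖φ i (q + 1) h n - φ i q h n‖ ≤ D / A)
    (hΔ₂ : ∀ i ∈ I, ∀ q h n, q < A → h + 1 < B → n < C → ‖φ i q (h + 1) n - φ i q h n‖ ≤ D / B)
    (hΔ₁₂ : ∀ i ∈ I, ∀ q h n, q + 1 < A → h + 1 < B → n < C →
      ‖φ i (q + 1) (h + 1) n - φ i (q + 1) h n - φ i q (h + 1) n + φ i q h n‖ ≤ D / (A * B))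
    (hΔ₃ : ∀ i ∈ I, ∀ q h n, q < A → h < B → n + 1 < C → ‖φ i q h (n + 1) - φ i q h n‖ ≤ D / C)
    (hΔ₁₃ : ∀ i ∈ I, ∀ q h n, q + 1 < A → h < B → n + 1 < C →
      ‖φ i (q + 1) h (n + 1) - φ i q h (n + 1) - φ i (q + 1) h n + φ i q h n‖ ≤ D / (A * C))
    (hΔ₂₃ : ∀ i ∈ I, ∀ q h n, q < A → h + 1 < B → n + 1 < C →
      ‖φ i q (h + 1) (n + 1) - φ i q h (n + 1) - φ i q (h + 1) n + φ i q h n‖ ≤ D / (B * C))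
    (hΔ₁₂₃ : ∀ i ∈ I, ∀ q h n, q + 1 < A → h + 1 < B → n + 1 < C →
      ‖(φ i (q + 1) (h + 1) (n + 1) - φ i (q + 1) h (n + 1) - φ i q (h + 1) (n + 1) + φ i q h (n + 1))
        - (φ i (q + 1) (h + 1) n - φ i (q + 1) h n - φ i q (h + 1) n + φ i q h n)‖ ≤ D / (A * B * C))
    (hMx : ∀ A' B' C', A' ≤ A → B' ≤ B → C' ≤ C →
      ∑ i ∈ I, ‖∑ q ∈ Finset.range A', ∑ h ∈ Finset.range B', ∑ n ∈ Finset.range C', a i q h n‖ ≤ Mx) :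
    ∑ i ∈ I, ‖∑ q ∈ Finset.range A, ∑ h ∈ Finset.range B, ∑ n ∈ Finset.range C,
      a i q h n * φ i q h n‖ ≤ 8 * D * Mx := by
  have hMx0 : 0 ≤ Mx := by
    have := hMx 0 0 0 (Nat.zero_le _) (Nat.zero_le _) (Nat.zero_le _); simpa using this
  rcases Nat.eq_zero_or_pos C with hC | hC
  · subst hC; simp; positivity
  have hCR : (0 : ℝ) < C := by exact_mod_cast hC
  -- partial sums in `n`
  set G : ι → ℕ → ℕ → ℕ → ℂ := fun i q h k => ∑ n ∈ Finset.range k, a i q h n with hG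
  have abel : ∀ i q h, ∑ n ∈ Finset.range C, a i q h n * φ i q h n =
      φ i q h (C - 1) * G i q h C -
        ∑ n ∈ Finset.range (C - 1), (φ i q h (n + 1) - φ i q h n) * G i q h (n + 1) := by
    intro i q h
    have := Finset.sum_range_by_parts (φ i q h) (a i q h) C
    simp only [smul_eq_mul] at this
    rw [hG, ← this]
    exact Finset.sum_congr rfl fun n _ => mul_comm _ _
  have hrw : ∀ i, ∑ q ∈ Finset.range A, ∑ h ∈ Finset.range B, ∑ n ∈ Finset.range C, a i q h n * φ i q h n =
      ∑ q ∈ Finset.range A, ∑ h ∈ Finset.range B, G i q h C * φ i q h (C - 1) -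
        ∑ n ∈ Finset.range (C - 1), ∑ q ∈ Finset.range A, ∑ h ∈ Finset.range B,
          G i q h (n + 1) * (φ i q h (n + 1) - φ i q h n) := by
    intro i
    have step : ∀ q, ∑ h ∈ Finset.range B, ∑ n ∈ Finset.range C, a i q h n * φ i q h n =
        ∑ h ∈ Finset.range B, G i q h C * φ i q h (C - 1) -
          ∑ n ∈ Finset.range (C - 1), ∑ h ∈ Finset.range B, G i q h (n + 1) * (φ i q h (n + 1) - φ i q h n) := by
      intro q
      rw [Finset.sum_congr rfl fun h _ => abel i q h, Finset.sum_sub_distrib, Finset.sum_comm]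
      congr 1
      · exact Finset.sum_congr rfl fun h _ => mul_comm _ _
      · exact Finset.sum_congr rfl fun n _ => Finset.sum_congr rfl fun h _ => mul_comm _ _
    rw [Finset.sum_congr rfl fun q _ => step q, Finset.sum_sub_distrib]
    congr 1
    rw [Finset.sum_comm]
  -- boundary term: `k = 2` with weights `φ(·,·,C-1)`
  have hT₁ : ∑ i ∈ I, ‖∑ q ∈ Finset.range A, ∑ h ∈ Finset.range B, G i q h C * φ i q h (C - 1)‖ ≤
      4 * D * Mx := by
    apply partialSummation₂ I A B (fun i q h => G i q h C) (fun i q h => φ i q h (C - 1)) hD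
    · intro i hi q h hq hh; exact hφ i hi q h (C - 1) hq hh (Nat.sub_lt hC one_pos)
    · intro i hi q h hq hh; exact hΔ₁ i hi q h (C - 1) hq hh (Nat.sub_lt hC one_pos)
    · intro i hi q h hq hh; exact hΔ₂ i hi q h (C - 1) hq hh (Nat.sub_lt hC one_pos)
    · intro i hi q h hq hh; exact hΔ₁₂ i hi q h (C - 1) hq hh (Nat.sub_lt hC one_pos)
    · intro A' B' hA' hB'
      have := hMx A' B' C hA' hB' le_rfl
      simpa [hG] using this
  -- difference terms: `k = 2` with weights `Δ₃φ(·,·,n)` and constant `D/C`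
  have hT₂ : ∀ n, n + 1 < C →
      ∑ i ∈ I, ‖∑ q ∈ Finset.range A, ∑ h ∈ Finset.range B,
        G i q h (n + 1) * (φ i q h (n + 1) - φ i q h n)‖ ≤ 4 * (D / C) * Mx := by
    intro n hn
    apply partialSummation₂ I A B (fun i q h => G i q h (n + 1)) (fun i q h => φ i q h (n + 1) - φ i q h n)
      (by positivity)
    · intro i hi q h hq hh; exact hΔ₃ i hi q h n hq hh hn
    · intro i hi q h hq hh
      have := hΔ₁₃ i hi q h n hq hh hn
      calc _ = ‖φ i (q + 1) h (n + 1) - φ i q h (n + 1) - φ i (q + 1) h n + φ i q h n‖ := by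
            congr 1; ring
        _ ≤ D / (A * C) := this
        _ = D / C / A := by rw [div_div, mul_comm]
    · intro i hi q h hq hh
      have := hΔ₂₃ i hi q h n hq hh hn
      calc _ = ‖φ i q (h + 1) (n + 1) - φ i q h (n + 1) - φ i q (h + 1) n + φ i q h n‖ := by
            congr 1; ring
        _ ≤ D / (B * C) := this
        _ = D / C / B := by rw [div_div, mul_comm]
    · intro i hi q h hq hh
      have := hΔ₁₂₃ i hi q h n hq hh hn
      calc _ = ‖(φ i (q + 1) (h + 1) (n + 1) - φ i (q + 1) h (n + 1) - φ i q (h + 1) (n + 1) + φ i q h (n + 1))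
          - (φ i (q + 1) (h + 1) n - φ i (q + 1) h n - φ i q (h + 1) n + φ i q h n)‖ := by
            congr 1; ring
        _ ≤ D / (A * B * C) := this
        _ = D / C / (A * B) := by rw [div_div, mul_comm]
    · intro A' B' hA' hB'
      have := hMx A' B' (n + 1) hA' hB' hn.le
      simpa [hG] using this
  calc ∑ i ∈ I, ‖∑ q ∈ Finset.range A, ∑ h ∈ Finset.range B, ∑ n ∈ Finset.range C, a i q h n * φ i q h n‖
      = ∑ i ∈ I, ‖∑ q ∈ Finset.range A, ∑ h ∈ Finset.range B, G i q h C * φ i q h (C - 1) -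
          ∑ n ∈ Finset.range (C - 1), ∑ q ∈ Finset.range A, ∑ h ∈ Finset.range B,
            G i q h (n + 1) * (φ i q h (n + 1) - φ i q h n)‖ := by
        refine Finset.sum_congr rfl fun i _ => ?_; rw [hrw i]
    _ ≤ ∑ i ∈ I, (‖∑ q ∈ Finset.range A, ∑ h ∈ Finset.range B, G i q h C * φ i q h (C - 1)‖ +
          ∑ n ∈ Finset.range (C - 1), ‖∑ q ∈ Finset.range A, ∑ h ∈ Finset.range B,
            G i q h (n + 1) * (φ i q h (n + 1) - φ i q h n)‖) := by
        refine Finset.sum_le_sum fun i _ => (norm_sub_le _ _).trans (add_le_add le_rfl (norm_sum_le _ _))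
    _ = ∑ i ∈ I, ‖∑ q ∈ Finset.range A, ∑ h ∈ Finset.range B, G i q h C * φ i q h (C - 1)‖ +
          ∑ n ∈ Finset.range (C - 1), ∑ i ∈ I, ‖∑ q ∈ Finset.range A, ∑ h ∈ Finset.range B,
            G i q h (n + 1) * (φ i q h (n + 1) - φ i q h n)‖ := by
        rw [Finset.sum_add_distrib, Finset.sum_comm]
    _ ≤ 4 * D * Mx + ∑ n ∈ Finset.range (C - 1), 4 * (D / C) * Mx := by
        apply add_le_add hT₁
        exact Finset.sum_le_sum fun n hn => hT₂ n (by rw [Finset.mem_range] at hn; omega)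
    _ = 4 * D * Mx + (C - 1 : ℕ) * (4 * (D / C) * Mx) := by
        rw [Finset.sum_const, Finset.card_range, nsmul_eq_mul]
    _ ≤ 8 * D * Mx := by
        have h1 : ((C - 1 : ℕ) : ℝ) ≤ C := by exact_mod_cast Nat.sub_le C 1
        have h2 : ((C - 1 : ℕ) : ℝ) * (4 * (D / C) * Mx) ≤ C * (4 * (D / C) * Mx) :=
          mul_le_mul_of_nonneg_right h1 (by positivity)
        have h3 : (C : ℝ) * (4 * (D / C) * Mx) = 4 * D * Mx := by field_simp
        linarith

/-! ### Mixed differences of `e(U)` -/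

section expDifferences

open Literature.NumberTheory.LFunctions.VdC (e norm_e e_add)

/-- `‖e(x) - 1‖ ≤ 2π|x|`. [folklore] -/
theorem norm_e_sub_one_le (x : ℝ) : ‖e x - 1‖ ≤ 2 * Real.pi * |x| := by
  have h := Real.norm_exp_I_mul_ofReal_sub_one_le (x := 2 * Real.pi * x)
  have he : e x = Complex.exp (Complex.I * ((2 * Real.pi * x : ℝ) : ℂ)) := by
    unfold e; rw [mul_comm]
  rw [he]
  refine h.trans (le_of_eq ?_)
  rw [Real.norm_eq_abs, abs_mul, abs_of_pos Real.two_pi_pos]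

/-- `‖e(x) - e(y)‖ ≤ 2π|x - y|`. [folklore] -/
theorem norm_e_sub_e_le (x y : ℝ) : ‖e x - e y‖ ≤ 2 * Real.pi * |x - y| := by
  have h1 : e x - e y = e y * (e (x - y) - 1) := by
    rw [mul_sub, mul_one, ← e_add]; congr 1; ring
  rw [h1, norm_mul, norm_e, one_mul]
  exact norm_e_sub_one_le _

/-- The second mixed difference of `e(U)` over a unit square with corner values `d` (base), `b`, `c`
and `a` (opposite corner): `e(a) - e(b) - e(c) + e(d) = e(d)[(e(x)-1)(e(y)-1) + e(x+y)(e(z)-1)]` with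
`x = b - d`, `y = c - d`, `z = a - b - c + d`; hence
`‖e(a) - e(b) - e(c) + e(d)‖ ≤ 4π²|b - d||c - d| + 2π|a - b - c + d|`. [folklore] -/
theorem norm_diff₂_e_le (a b c d : ℝ) :
    ‖e a - e b - e c + e d‖ ≤
      4 * Real.pi ^ 2 * (|b - d| * |c - d|) + 2 * Real.pi * |a - b - c + d| := by
  have hid : e a - e b - e c + e d =
      e d * ((e (b - d) - 1) * (e (c - d) - 1) + e (b - d + (c - d)) * (e (a - b - c + d) - 1)) := by
    have h1 : e d * e (b - d) = e b := by rw [← e_add]; congr 1; ring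
    have h2 : e d * e (c - d) = e c := by rw [← e_add]; congr 1; ring
    have h3 : e d * e (b - d + (c - d)) = e (b + c - d) := by rw [← e_add]; congr 1; ring
    have h4 : e (b - d) * e (c - d) = e (b - d + (c - d)) := (e_add _ _).symm
    have h5 : e d * (e (b - d + (c - d)) * e (a - b - c + d)) = e a := by
      rw [← e_add, ← e_add]; congr 1; ring
    calc e a - e b - e c + e d
        = e d * (e (b - d + (c - d)) * e (a - b - c + d)) - e d * e (b - d) - e d * e (c - d) + e d := by
          rw [h5, h1, h2]
      _ = _ := by rw [← h4]; ring
  rw [hid, norm_mul, norm_e, one_mul]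
  refine (norm_add_le _ _).trans (add_le_add ?_ ?_)
  · rw [norm_mul]
    have h1 := norm_e_sub_one_le (b - d)
    have h2 := norm_e_sub_one_le (c - d)
    calc ‖e (b - d) - 1‖ * ‖e (c - d) - 1‖ ≤ (2 * Real.pi * |b - d|) * (2 * Real.pi * |c - d|) :=
          mul_le_mul h1 h2 (norm_nonneg _) (by positivity)
      _ = 4 * Real.pi ^ 2 * (|b - d| * |c - d|) := by ring
  · rw [norm_mul, norm_e, one_mul]
    exact norm_e_sub_one_le _

/-- The third mixed difference of `e(U)` over a unit cube with corner values `u_{abc}`: with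
`x_c = u_{10c} - u_{00c}`, `y_c = u_{01c} - u_{00c}`, `z_c = u_{11c} - u_{10c} - u_{01c} + u_{00c}`,
`w = u_{001} - u_{000}`,
`‖Δ₃Δ₂Δ₁ e(U)‖ ≤ 2π|w|(4π²|x₁||y₁| + 2π|z₁|) + 4π²|x₁-x₀||y₁| + 4π²|x₀||y₁-y₀|
  + 4π²(|x₁-x₀| + |y₁-y₀|)|z₁| + 2π|z₁-z₀|`. [folklore] -/
theorem norm_diff₃_e_le (u000 u100 u010 u110 u001 u101 u011 u111 : ℝ) :
    ‖(e u111 - e u101 - e u011 + e u001) - (e u110 - e u100 - e u010 + e u000)‖ ≤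
      2 * Real.pi * |u001 - u000| *
          (4 * Real.pi ^ 2 * (|u101 - u001| * |u011 - u001|) +
            2 * Real.pi * |u111 - u101 - u011 + u001|) +
        4 * Real.pi ^ 2 * (|(u101 - u001) - (u100 - u000)| * |u011 - u001|) +
        4 * Real.pi ^ 2 * (|u100 - u000| * |(u011 - u001) - (u010 - u000)|) +
        4 * Real.pi ^ 2 * ((|(u101 - u001) - (u100 - u000)| + |(u011 - u001) - (u010 - u000)|) *
          |u111 - u101 - u011 + u001|) +
        2 * Real.pi * |(u111 - u101 - u011 + u001) - (u110 - u100 - u010 + u000)| := by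
  -- notation
  set x₀ := u100 - u000 with hx₀
  set y₀ := u010 - u000 with hy₀
  set z₀ := u110 - u100 - u010 + u000 with hz₀
  set x₁ := u101 - u001 with hx₁
  set y₁ := u011 - u001 with hy₁
  set z₁ := u111 - u101 - u011 + u001 with hz₁
  set w := u001 - u000 with hw
  set W : ℝ → ℝ → ℝ → ℂ := fun x y z => (e x - 1) * (e y - 1) + e (x + y) * (e z - 1) with hW
  -- the two squares
  have sq : ∀ a b c d : ℝ, e a - e b - e c + e d = e d * W (b - d) (c - d) (a - b - c + d) := by
    intro a b c d
    simp only [hW]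
    have h1 : e d * e (b - d) = e b := by rw [← e_add]; congr 1; ring
    have h2 : e d * e (c - d) = e c := by rw [← e_add]; congr 1; ring
    have h4 : e (b - d) * e (c - d) = e (b - d + (c - d)) := (e_add _ _).symm
    have h5 : e d * (e (b - d + (c - d)) * e (a - b - c + d)) = e a := by
      rw [← e_add, ← e_add]; congr 1; ring
    calc e a - e b - e c + e d
        = e d * (e (b - d + (c - d)) * e (a - b - c + d)) - e d * e (b - d) - e d * e (c - d) + e d := by
          rw [h5, h1, h2]
      _ = _ := by rw [← h4]; ring
  have s1 := sq u111 u101 u011 u001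
  have s0 := sq u110 u100 u010 u000
  rw [← hx₁, ← hy₁] at s1
  rw [← hx₀, ← hy₀] at s0
  have ez1 : u111 - u101 - u011 + u001 = z₁ := by rw [hz₁]
  have ez0 : u110 - u100 - u010 + u000 = z₀ := by rw [hz₀]
  rw [ez1] at s1; rw [ez0] at s0
  have he : e u001 = e u000 * e w := by rw [← e_add]; congr 1; rw [hw]; ring
  have key : (e u111 - e u101 - e u011 + e u001) - (e u110 - e u100 - e u010 + e u000) =
      e u000 * ((e w - 1) * W x₁ y₁ z₁ + (W x₁ y₁ z₁ - W x₀ y₀ z₀)) := by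
    rw [s1, s0, he]; ring
  rw [key, norm_mul, norm_e, one_mul]
  -- bounds for `W`
  have hWb : ∀ x y z : ℝ, ‖W x y z‖ ≤ 4 * Real.pi ^ 2 * (|x| * |y|) + 2 * Real.pi * |z| := by
    intro x y z
    simp only [hW]
    refine (norm_add_le _ _).trans (add_le_add ?_ ?_)
    · rw [norm_mul]
      calc ‖e x - 1‖ * ‖e y - 1‖ ≤ (2 * Real.pi * |x|) * (2 * Real.pi * |y|) :=
            mul_le_mul (norm_e_sub_one_le x) (norm_e_sub_one_le y) (norm_nonneg _) (by positivity)
        _ = 4 * Real.pi ^ 2 * (|x| * |y|) := by ring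
    · rw [norm_mul, norm_e, one_mul]; exact norm_e_sub_one_le z
  have hWd : W x₁ y₁ z₁ - W x₀ y₀ z₀ = (e x₁ - e x₀) * (e y₁ - 1) + (e x₀ - 1) * (e y₁ - e y₀)
      + (e (x₁ + y₁) - e (x₀ + y₀)) * (e z₁ - 1) + e (x₀ + y₀) * (e z₁ - e z₀) := by
    simp only [hW]; ring
  refine (norm_add_le _ _).trans ?_
  have t1 : ‖(e w - 1) * W x₁ y₁ z₁‖ ≤ 2 * Real.pi * |w| *
      (4 * Real.pi ^ 2 * (|x₁| * |y₁|) + 2 * Real.pi * |z₁|) := by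
    rw [norm_mul]
    exact mul_le_mul (norm_e_sub_one_le w) (hWb x₁ y₁ z₁) (norm_nonneg _) (by positivity)
  have t2 : ‖W x₁ y₁ z₁ - W x₀ y₀ z₀‖ ≤ 4 * Real.pi ^ 2 * (|x₁ - x₀| * |y₁|) +
      4 * Real.pi ^ 2 * (|x₀| * |y₁ - y₀|) +
      4 * Real.pi ^ 2 * ((|x₁ - x₀| + |y₁ - y₀|) * |z₁|) + 2 * Real.pi * |z₁ - z₀| := by
    rw [hWd]
    refine (norm_add_le _ _).trans (add_le_add ((norm_add_le _ _).trans (add_le_add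
      ((norm_add_le _ _).trans (add_le_add ?_ ?_)) ?_)) ?_)
    · rw [norm_mul]
      calc ‖e x₁ - e x₀‖ * ‖e y₁ - 1‖ ≤ (2 * Real.pi * |x₁ - x₀|) * (2 * Real.pi * |y₁|) :=
            mul_le_mul (norm_e_sub_e_le _ _) (norm_e_sub_one_le _) (norm_nonneg _) (by positivity)
        _ = _ := by ring
    · rw [norm_mul]
      calc ‖e x₀ - 1‖ * ‖e y₁ - e y₀‖ ≤ (2 * Real.pi * |x₀|) * (2 * Real.pi * |y₁ - y₀|) :=
            mul_le_mul (norm_e_sub_one_le _) (norm_e_sub_e_le _ _) (norm_nonneg _) (by positivity)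
        _ = _ := by ring
    · rw [norm_mul]
      have h1 : ‖e (x₁ + y₁) - e (x₀ + y₀)‖ ≤ 2 * Real.pi * (|x₁ - x₀| + |y₁ - y₀|) := by
        refine (norm_e_sub_e_le _ _).trans ?_
        have : |x₁ + y₁ - (x₀ + y₀)| ≤ |x₁ - x₀| + |y₁ - y₀| := by
          rw [show x₁ + y₁ - (x₀ + y₀) = (x₁ - x₀) + (y₁ - y₀) by ring]; exact abs_add_le _ _
        nlinarith [Real.pi_pos]
      calc ‖e (x₁ + y₁) - e (x₀ + y₀)‖ * ‖e z₁ - 1‖ ≤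
            (2 * Real.pi * (|x₁ - x₀| + |y₁ - y₀|)) * (2 * Real.pi * |z₁|) :=
            mul_le_mul h1 (norm_e_sub_one_le _) (norm_nonneg _) (by positivity)
        _ = _ := by ring
    · rw [norm_mul, norm_e, one_mul]; exact norm_e_sub_e_le _ _
  linarith

end expDifferences

end RobertSargos
end Literature.NumberTheory.LFunctions
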